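import Mathlib
import Summits.AtomisticToContinuum.HydrodynamicLimit.Theorems.JaynesSqueezeEntropicWeakStrongHSCalculus
import Literature.Analysis.FluidPDE.ReleaseKernelFamily
import HarnessLib

/-!
# `EntropicWeakStrongHS` (stmt-AtomisticToContinuum-13461), calculus II: smoothness of the
# entropy-variable field and the pointwise bookkeeping identities of the classical solution

Along a classical hard-sphere Euler solution on `[0, T) × 𝕋³` under the low-density equation of
state: the entropy-variable field `λ`, the conservative field `U = (ρ, ρu, E)`, the entropy
`h(U)` and the fluxes `fᵢ(U)` are jointly smooth on `[0, T) × 𝕋³`; and pointwise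
`λ·U - h(U) = ρ Z(ρσ³)`, `∂ₜλ·U = ∂ₜ(ρZ(ρσ³))`, `Σᵢ ∂ᵢλ·fᵢ(U) = Σᵢ ∂ᵢ(ρZ(ρσ³)uᵢ)` — the
differential form of "entropy conservation + weak form against its own entropy variables"
(`Γ ≡ 0`) used by the abstract Dafermos shell. The objects of the route statement
(`θo, h, flux, pair`) enter as parameters with their defining equations.
-/

noncomputable section

open Set Filter MeasureTheory Function
open scoped Topology InnerProductSpace ContDiff

namespace Summit.AtomisticToContinuum.HydrodynamicLimit.Theorems.EntropicWeakStrong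

open Literature.MathematicalPhysics.KineticTheory Literature.Analysis.FunctionSpaces

/-! ### Small algebraic facts about the objects of the statement -/

/-- The kinetic temperature of a conservative state built from primitive variables is the
temperature: `θo(ρ, ρu, ρ(|u|²/2 + 3θ/2)) = θ` (`ρ ≠ 0`). -/
theorem thetaOf_consVar (θo : (ℝ × V3 × ℝ) → ℝ)
    (hθo : θo = fun U => 2 / 3 * (U.2.2 / U.1 - ‖U.2.1‖ ^ 2 / (2 * U.1 ^ 2)))
    {r : ℝ} (hr : r ≠ 0) (w : V3) (ϑ : ℝ) :
    θo (r, r • w, totalEnergyDensity r w ϑ) = ϑ := by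
  subst hθo
  simp only [totalEnergyDensity, norm_smul, Real.norm_eq_abs, mul_pow, sq_abs]
  field_simp
  ring

/-- Pairing against a multiple of a coordinate vector picks a component. -/
theorem sum_mul_smul_single (L : V3) (c : ℝ) (i : Fin 3) :
    (∑ j, L j * (c • EuclideanSpace.single i (1 : ℝ)) j) = c * L i := by
  simp only [PiLp.smul_apply, PiLp.single_apply, smul_eq_mul, mul_ite, mul_one, mul_zero]
  rw [Finset.sum_ite_eq']
  simp [mul_comm]

/-- **`λ·U - h(U) = ρ Z`** pointwise: for a conservative state `U = (ρ, ρu, E(ρ,u,θ))` with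
`ρ, θ ≠ 0`, entropy variables `λ = (-(3/2 log θ - log ρ - f) + 5/2 - |u|²/(2θ) + g, u/θ, -1/θ)`
and entropy `h(U) = -ρ(3/2 log θo(U) - log ρ - f)`, one has `λ·U - h(U) = ρ (1 + g)`
(with `g = ρσ³f'(ρσ³)` this is `ρ Z(ρσ³) = p/θ`). -/
theorem pair_entropyVar_consVar_sub_entropy (θo : (ℝ × V3 × ℝ) → ℝ)
    (hθo : θo = fun U => 2 / 3 * (U.2.2 / U.1 - ‖U.2.1‖ ^ 2 / (2 * U.1 ^ 2)))
    (pair : (ℝ × V3 × ℝ) → (ℝ × V3 × ℝ) → ℝ)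
    (hpair : pair = fun L U => L.1 * U.1 + (∑ j, L.2.1 j * U.2.1 j) + L.2.2 * U.2.2)
    {r ϑ : ℝ} (hr : r ≠ 0) (hϑ : ϑ ≠ 0) (w : V3) (f g : ℝ) :
    pair ((-(3 / 2 * Real.log ϑ - Real.log r - f) + 5 / 2 - ‖w‖ ^ 2 / (2 * ϑ) + g : ℝ),
        ϑ⁻¹ • w, -ϑ⁻¹) (r, r • w, totalEnergyDensity r w ϑ) -
      -((r, r • w, totalEnergyDensity r w ϑ).1 *
        (3 / 2 * Real.log (θo (r, r • w, totalEnergyDensity r w ϑ)) -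
          Real.log (r, r • w, totalEnergyDensity r w ϑ).1 - f)) = r * (1 + g) := by
  rw [thetaOf_consVar θo hθo hr w ϑ]
  subst hpair
  simp only [totalEnergyDensity, PiLp.smul_apply, smul_eq_mul, EuclideanSpace.norm_sq_eq,
    Real.norm_eq_abs, sq_abs, Fin.sum_univ_three]
  field_simp
  ring

/-! ### Along a classical solution: smoothness -/

section Solution

variable {σ T η₀ : ℝ} {F : ℝ → ℝ} {ρ θ : ℝ → T3 → ℝ} {u : ℝ → T3 → V3}

/-- The density part `log ρ + F(ρσ³) + ρσ³F'(ρσ³)`, `log θ`, `θ⁻¹` and the packing are jointly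
smooth along the solution (space–time lifts). -/
theorem smooth_aux (hE : IsHardSphereEulerSolution σ T ρ u θ) (hσ : 0 < σ)
    (hFa : AnalyticOnNhd ℝ F (Ioo (-η₀) η₀)) (hpack : ∀ t ∈ Ico 0 T, ∀ x, ρ t x * σ ^ 3 < η₀) :
    ContDiffOn ℝ ∞ (fun p => Real.log (Torus.stLift θ p)) (Ico 0 T ×ˢ univ) ∧
    ContDiffOn ℝ ∞ (fun p => Real.log (Torus.stLift ρ p)) (Ico 0 T ×ˢ univ) ∧
    ContDiffOn ℝ ∞ (fun p => (Torus.stLift θ p)⁻¹) (Ico 0 T ×ˢ univ) ∧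
    ContDiffOn ℝ ∞ (fun p => F (Torus.stLift ρ p * σ ^ 3)) (Ico 0 T ×ˢ univ) ∧
    ContDiffOn ℝ ∞ (fun p => deriv F (Torus.stLift ρ p * σ ^ 3)) (Ico 0 T ×ˢ univ) := by
  have hρ : ContDiffOn ℝ ∞ (Torus.stLift ρ) (Ico 0 T ×ˢ univ) := hE.smooth_density
  have hθ : ContDiffOn ℝ ∞ (Torus.stLift θ) (Ico 0 T ×ˢ univ) := hE.smooth_temperature
  have hθ0 : ∀ p ∈ Ico (0:ℝ) T ×ˢ (univ : Set (EuclideanSpace ℝ (Fin 3))), Torus.stLift θ p ≠ 0 :=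
    fun p hp => (hE.temperature_pos p.1 (mem_prod.1 hp).1 _).ne'
  have hρ0 : ∀ p ∈ Ico (0:ℝ) T ×ˢ (univ : Set (EuclideanSpace ℝ (Fin 3))), Torus.stLift ρ p ≠ 0 :=
    fun p hp => (hE.density_pos p.1 (mem_prod.1 hp).1 _).ne'
  have hmaps : MapsTo (fun p => Torus.stLift ρ p * σ ^ 3) (Ico (0:ℝ) T ×ˢ univ) (Ioo (-η₀) η₀) :=
    fun p hp => (packing_mem hE hσ hpack (mem_prod.1 hp).1 _).2
  have hlin : ContDiffOn ℝ ∞ (fun p => Torus.stLift ρ p * σ ^ 3) (Ico 0 T ×ˢ univ) :=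
    hρ.mul contDiffOn_const
  exact ⟨hθ.log hθ0, hρ.log hρ0, hθ.inv hθ0,
    (hFa.contDiffOn_of_completeSpace (n := ∞)).comp hlin hmaps,
    (hFa.deriv.contDiffOn_of_completeSpace (n := ∞)).comp hlin hmaps⟩

/-- **The entropy-variable field is jointly smooth** on `[0, T) × 𝕋³`. -/
theorem isSmoothSpaceTimeOn_entropyVar (hE : IsHardSphereEulerSolution σ T ρ u θ) (hσ : 0 < σ)
    (hFa : AnalyticOnNhd ℝ F (Ioo (-η₀) η₀)) (hF : EqOn hsExcessFreeEnergy F (Ico 0 η₀))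
    (hpack : ∀ t ∈ Ico 0 T, ∀ x, ρ t x * σ ^ 3 < η₀) :
    Torus.IsSmoothSpaceTimeOn (Ico 0 T) (fun s y => ((-(3 / 2 * Real.log (θ s y) -
        Real.log (ρ s y) - hsExcessFreeEnergy (ρ s y * σ ^ 3)) + 5 / 2 - ‖u s y‖ ^ 2 / (2 * θ s y) +
        ρ s y * σ ^ 3 * deriv hsExcessFreeEnergy (ρ s y * σ ^ 3) : ℝ),
        (θ s y)⁻¹ • u s y, -(θ s y)⁻¹)) := by
  obtain ⟨hlogθ, hlogρ, hinvθ, hFc, hF'c⟩ := smooth_aux hE hσ hFa hpack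
  have hρ : ContDiffOn ℝ ∞ (Torus.stLift ρ) (Ico 0 T ×ˢ univ) := hE.smooth_density
  have hθ : ContDiffOn ℝ ∞ (Torus.stLift θ) (Ico 0 T ×ˢ univ) := hE.smooth_temperature
  have hu : ContDiffOn ℝ ∞ (Torus.stLift u) (Ico 0 T ×ˢ univ) := hE.smooth_velocity
  have hθ0 : ∀ p ∈ Ico (0:ℝ) T ×ˢ (univ : Set (EuclideanSpace ℝ (Fin 3))),
      2 * Torus.stLift θ p ≠ 0 :=
    fun p hp => mul_ne_zero two_ne_zero (hE.temperature_pos p.1 (mem_prod.1 hp).1 _).ne'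
  -- the normal form of the first component is smooth
  have h1 : ContDiffOn ℝ ∞ (fun p => -(3 / 2 * Real.log (Torus.stLift θ p)) +
      (Real.log (Torus.stLift ρ p) + F (Torus.stLift ρ p * σ ^ 3) +
        Torus.stLift ρ p * σ ^ 3 * deriv F (Torus.stLift ρ p * σ ^ 3)) + 5 / 2 -
      ‖Torus.stLift u p‖ ^ 2 / (2 * Torus.stLift θ p)) (Ico 0 T ×ˢ univ) := by
    refine ContDiffOn.sub (ContDiffOn.add (ContDiffOn.add ?_ ?_) contDiffOn_const) ?_
    · exact (contDiffOn_const.mul hlogθ).neg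
    · exact (hlogρ.add hFc).add ((hρ.mul contDiffOn_const).mul hF'c)
    · exact (hu.norm_sq (𝕜 := ℝ)).div (contDiffOn_const.mul hθ) hθ0
  have h2 : ContDiffOn ℝ ∞ (fun p => (Torus.stLift θ p)⁻¹ • Torus.stLift u p) (Ico 0 T ×ˢ univ) :=
    hinvθ.smul hu
  have h3 : ContDiffOn ℝ ∞ (fun p => -(Torus.stLift θ p)⁻¹) (Ico 0 T ×ˢ univ) := hinvθ.neg
  have h123 := h1.prodMk (h2.prodMk h3)
  refine h123.congr fun p hp => ?_
  obtain ⟨s, y⟩ := p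
  have hs : s ∈ Ico 0 T := (mem_prod.1 hp).1
  exact Prod.ext (entropyVar_fst_eq hE hσ hF hpack hs (Torus.proj y)) rfl

/-- **The conservative field `U = (ρ, ρu, E)` is jointly smooth** on `[0, T) × 𝕋³`. -/
theorem isSmoothSpaceTimeOn_consVar (hE : IsHardSphereEulerSolution σ T ρ u θ) :
    Torus.IsSmoothSpaceTimeOn (Ico 0 T)
      (fun s y => (ρ s y, ρ s y • u s y, totalEnergyDensity (ρ s y) (u s y) (θ s y))) := by
  have hρ : ContDiffOn ℝ ∞ (Torus.stLift ρ) (Ico 0 T ×ˢ univ) := hE.smooth_density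
  have hθ : ContDiffOn ℝ ∞ (Torus.stLift θ) (Ico 0 T ×ˢ univ) := hE.smooth_temperature
  have hu : ContDiffOn ℝ ∞ (Torus.stLift u) (Ico 0 T ×ˢ univ) := hE.smooth_velocity
  have hEn : ContDiffOn ℝ ∞ (fun p => Torus.stLift ρ p * (‖Torus.stLift u p‖ ^ 2 / 2 +
      3 / 2 * Torus.stLift θ p)) (Ico 0 T ×ˢ univ) :=
    hρ.mul (((hu.norm_sq (𝕜 := ℝ)).div_const 2).add (contDiffOn_const.mul hθ))
  exact hρ.prodMk ((hρ.smul hu).prodMk hEn)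

/-- **The entropy of the classical state is jointly smooth**: `(s, y) ↦ h(U(s, y))` equals the
smooth field `-ρ(3/2 log θ - log ρ - F(ρσ³))` on `[0, T) × 𝕋³`. -/
theorem isSmoothSpaceTimeOn_entropy_consVar (hE : IsHardSphereEulerSolution σ T ρ u θ)
    (hσ : 0 < σ) (hFa : AnalyticOnNhd ℝ F (Ioo (-η₀) η₀))
    (hF : EqOn hsExcessFreeEnergy F (Ico 0 η₀)) (hpack : ∀ t ∈ Ico 0 T, ∀ x, ρ t x * σ ^ 3 < η₀)
    (θo : (ℝ × V3 × ℝ) → ℝ)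
    (hθo : θo = fun U => 2 / 3 * (U.2.2 / U.1 - ‖U.2.1‖ ^ 2 / (2 * U.1 ^ 2)))
    (h : (ℝ × V3 × ℝ) → ℝ)
    (hh : h = fun U => -(U.1 * (3 / 2 * Real.log (θo U) - Real.log U.1 -
      hsExcessFreeEnergy (U.1 * σ ^ 3)))) :
    Torus.IsSmoothSpaceTimeOn (Ico 0 T)
      (fun s y => h (ρ s y, ρ s y • u s y, totalEnergyDensity (ρ s y) (u s y) (θ s y))) := by
  obtain ⟨hlogθ, hlogρ, -, hFc, -⟩ := smooth_aux hE hσ hFa hpack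
  have hρ : ContDiffOn ℝ ∞ (Torus.stLift ρ) (Ico 0 T ×ˢ univ) := hE.smooth_density
  have hsm : ContDiffOn ℝ ∞ (fun p => -(Torus.stLift ρ p * (3 / 2 * Real.log (Torus.stLift θ p) -
      Real.log (Torus.stLift ρ p) - F (Torus.stLift ρ p * σ ^ 3)))) (Ico 0 T ×ˢ univ) :=
    (hρ.mul (((contDiffOn_const.mul hlogθ).sub hlogρ).sub hFc)).neg
  subst hh
  refine hsm.congr fun p hp => ?_
  obtain ⟨s, y⟩ := p
  have hs : s ∈ Ico 0 T := (mem_prod.1 hp).1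
  have hρ0 : ρ s (Torus.proj y) ≠ 0 := (hE.density_pos s hs (Torus.proj y)).ne'
  obtain ⟨e1, -, -⟩ := eos_eqs hF (θ s (Torus.proj y)) (packing_mem hE hσ hpack hs (Torus.proj y)).1
  simp only [Torus.stLift_apply, thetaOf_consVar θo hθo hρ0, e1]

/-- **The fluxes of the classical state are jointly smooth**: `(s, y) ↦ fᵢ(U(s, y))` equals the
smooth field `(ρuᵢ, uᵢ ρu + p eᵢ, (E + p)uᵢ)`, `p = ρθ(1 + ρσ³F'(ρσ³))`, on `[0, T) × 𝕋³`. -/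
theorem isSmoothSpaceTimeOn_flux_consVar (hE : IsHardSphereEulerSolution σ T ρ u θ)
    (hσ : 0 < σ) (hFa : AnalyticOnNhd ℝ F (Ioo (-η₀) η₀))
    (hF : EqOn hsExcessFreeEnergy F (Ico 0 η₀)) (hpack : ∀ t ∈ Ico 0 T, ∀ x, ρ t x * σ ^ 3 < η₀)
    (θo : (ℝ × V3 × ℝ) → ℝ)
    (hθo : θo = fun U => 2 / 3 * (U.2.2 / U.1 - ‖U.2.1‖ ^ 2 / (2 * U.1 ^ 2)))
    (flux : Fin 3 → (ℝ × V3 × ℝ) → (ℝ × V3 × ℝ))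
    (hflux : flux = fun i U => (U.2.1 i, (U.2.1 i / U.1) • U.2.1 +
      hsPressure σ U.1 (θo U) • EuclideanSpace.single i (1 : ℝ),
      (U.2.2 + hsPressure σ U.1 (θo U)) * U.2.1 i / U.1)) (i : Fin 3) :
    Torus.IsSmoothSpaceTimeOn (Ico 0 T)
      (fun s y => flux i (ρ s y, ρ s y • u s y, totalEnergyDensity (ρ s y) (u s y) (θ s y))) := by
  obtain ⟨-, -, -, -, hF'c⟩ := smooth_aux hE hσ hFa hpack
  have hρ : ContDiffOn ℝ ∞ (Torus.stLift ρ) (Ico 0 T ×ˢ univ) := hE.smooth_density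
  have hθ : ContDiffOn ℝ ∞ (Torus.stLift θ) (Ico 0 T ×ˢ univ) := hE.smooth_temperature
  have hu : ContDiffOn ℝ ∞ (Torus.stLift u) (Ico 0 T ×ˢ univ) := hE.smooth_velocity
  have hui : ContDiffOn ℝ ∞ (fun p => Torus.stLift u p i) (Ico 0 T ×ˢ univ) :=
    ((EuclideanSpace.proj i : V3 →L[ℝ] ℝ).contDiff.comp_contDiffOn hu)
  have hp : ContDiffOn ℝ ∞ (fun p => Torus.stLift ρ p * Torus.stLift θ p *
      (1 + Torus.stLift ρ p * σ ^ 3 * deriv F (Torus.stLift ρ p * σ ^ 3))) (Ico 0 T ×ˢ univ) :=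
    (hρ.mul hθ).mul (contDiffOn_const.add ((hρ.mul contDiffOn_const).mul hF'c))
  have hEn : ContDiffOn ℝ ∞ (fun p => Torus.stLift ρ p * (‖Torus.stLift u p‖ ^ 2 / 2 +
      3 / 2 * Torus.stLift θ p)) (Ico 0 T ×ˢ univ) :=
    hρ.mul (((hu.norm_sq (𝕜 := ℝ)).div_const 2).add (contDiffOn_const.mul hθ))
  have hsm : ContDiffOn ℝ ∞ (fun p => (Torus.stLift ρ p * Torus.stLift u p i,
      Torus.stLift u p i • (Torus.stLift ρ p • Torus.stLift u p) +
        (Torus.stLift ρ p * Torus.stLift θ p *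
          (1 + Torus.stLift ρ p * σ ^ 3 * deriv F (Torus.stLift ρ p * σ ^ 3))) •
          EuclideanSpace.single i (1 : ℝ),
      (Torus.stLift ρ p * (‖Torus.stLift u p‖ ^ 2 / 2 + 3 / 2 * Torus.stLift θ p) +
        Torus.stLift ρ p * Torus.stLift θ p *
          (1 + Torus.stLift ρ p * σ ^ 3 * deriv F (Torus.stLift ρ p * σ ^ 3))) *
        Torus.stLift u p i)) (Ico 0 T ×ˢ univ) :=
    (hρ.mul hui).prodMk (((hui.smul (hρ.smul hu)).add (hp.smul contDiffOn_const)).prodMk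
      ((hEn.add hp).mul hui))
  subst hflux
  refine hsm.congr fun p hp' => ?_
  obtain ⟨s, y⟩ := p
  have hs : s ∈ Ico 0 T := (mem_prod.1 hp').1
  have hρ0 : ρ s (Torus.proj y) ≠ 0 := (hE.density_pos s hs (Torus.proj y)).ne'
  obtain ⟨-, -, e3⟩ := eos_eqs hF (θ s (Torus.proj y)) (packing_mem hE hσ hpack hs (Torus.proj y)).1
  simp only [Torus.stLift_apply, thetaOf_consVar θo hθo hρ0, e3]
  refine Prod.ext ?_ (Prod.ext ?_ ?_)
  · simp only [PiLp.smul_apply, smul_eq_mul]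
  · simp only [PiLp.smul_apply, smul_eq_mul]
    rw [mul_div_cancel_left₀ _ hρ0]
  · simp only [PiLp.smul_apply, smul_eq_mul, totalEnergyDensity]
    field_simp

/-- The auxiliary field `ρ Z(ρσ³) = ρ(1 + ρσ³F'(ρσ³))` (equal to `λ·U - h(U) = p/θ`) is jointly
smooth on `[0, T) × 𝕋³`. -/
theorem isSmoothSpaceTimeOn_rhoZ (hE : IsHardSphereEulerSolution σ T ρ u θ) (hσ : 0 < σ)
    (hFa : AnalyticOnNhd ℝ F (Ioo (-η₀) η₀)) (hpack : ∀ t ∈ Ico 0 T, ∀ x, ρ t x * σ ^ 3 < η₀) :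
    Torus.IsSmoothSpaceTimeOn (Ico 0 T)
      (fun s y => ρ s y * (1 + ρ s y * σ ^ 3 * deriv F (ρ s y * σ ^ 3))) := by
  obtain ⟨-, -, -, -, hF'c⟩ := smooth_aux hE hσ hFa hpack
  have hρ : ContDiffOn ℝ ∞ (Torus.stLift ρ) (Ico 0 T ×ˢ univ) := hE.smooth_density
  exact hρ.mul (contDiffOn_const.add ((hρ.mul contDiffOn_const).mul hF'c))

/-! ### Along a classical solution: the pointwise bookkeeping identities -/

/-- **`λ·U - h(U) = ρ Z(ρσ³)`** along the solution. -/
theorem pair_entropyVar_sub_entropy_eq (hE : IsHardSphereEulerSolution σ T ρ u θ) (hσ : 0 < σ)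
    (hF : EqOn hsExcessFreeEnergy F (Ico 0 η₀)) (hpack : ∀ t ∈ Ico 0 T, ∀ x, ρ t x * σ ^ 3 < η₀)
    (θo : (ℝ × V3 × ℝ) → ℝ)
    (hθo : θo = fun U => 2 / 3 * (U.2.2 / U.1 - ‖U.2.1‖ ^ 2 / (2 * U.1 ^ 2)))
    (h : (ℝ × V3 × ℝ) → ℝ)
    (hh : h = fun U => -(U.1 * (3 / 2 * Real.log (θo U) - Real.log U.1 -
      hsExcessFreeEnergy (U.1 * σ ^ 3))))
    (pair : (ℝ × V3 × ℝ) → (ℝ × V3 × ℝ) → ℝ)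
    (hpair : pair = fun L U => L.1 * U.1 + (∑ j, L.2.1 j * U.2.1 j) + L.2.2 * U.2.2)
    {t : ℝ} (ht : t ∈ Ico 0 T) (x : T3) :
    pair ((-(3 / 2 * Real.log (θ t x) - Real.log (ρ t x) - hsExcessFreeEnergy (ρ t x * σ ^ 3)) +
        5 / 2 - ‖u t x‖ ^ 2 / (2 * θ t x) +
        ρ t x * σ ^ 3 * deriv hsExcessFreeEnergy (ρ t x * σ ^ 3) : ℝ),
        (θ t x)⁻¹ • u t x, -(θ t x)⁻¹) (ρ t x, ρ t x • u t x, totalEnergyDensity (ρ t x) (u t x) (θ t x)) -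
      h (ρ t x, ρ t x • u t x, totalEnergyDensity (ρ t x) (u t x) (θ t x)) =
      ρ t x * (1 + ρ t x * σ ^ 3 * deriv F (ρ t x * σ ^ 3)) := by
  have hρ0 : ρ t x ≠ 0 := (hE.density_pos t ht x).ne'
  have hθ0 : θ t x ≠ 0 := (hE.temperature_pos t ht x).ne'
  obtain ⟨-, e2, -⟩ := eos_eqs hF (θ t x) (packing_mem hE hσ hpack ht x).1
  subst hh
  have key := pair_entropyVar_consVar_sub_entropy θo hθo pair hpair hρ0 hθ0 (u t x)
    (hsExcessFreeEnergy (ρ t x * σ ^ 3)) (ρ t x * σ ^ 3 * deriv hsExcessFreeEnergy (ρ t x * σ ^ 3))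
  rw [e2] at key ⊢
  rw [← key]

/-- **`∂ₜ(ρZ(ρσ³)) = γ ∂ₜρ`** along the solution, `γ = 1 + 2ηF'(η) + η²F''(η)`. -/
theorem timeDerivWithin_rhoZ_eq (hE : IsHardSphereEulerSolution σ T ρ u θ) (hσ : 0 < σ)
    (hFa : AnalyticOnNhd ℝ F (Ioo (-η₀) η₀)) (hpack : ∀ t ∈ Ico 0 T, ∀ x, ρ t x * σ ^ 3 < η₀)
    {t : ℝ} (ht : t ∈ Ico 0 T) (x : T3) :
    Torus.timeDerivWithin (Ico 0 T) (fun s y => ρ s y * (1 + ρ s y * σ ^ 3 * deriv F (ρ s y * σ ^ 3))) t x =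
      (1 + 2 * (ρ t x * σ ^ 3) * deriv F (ρ t x * σ ^ 3) +
        (ρ t x * σ ^ 3) ^ 2 * deriv (deriv F) (ρ t x * σ ^ 3)) * Torus.timeDerivWithin (Ico 0 T) ρ t x := by
  have hU : UniqueDiffOn ℝ (Ico (0 : ℝ) T) := uniqueDiffOn_Ico 0 T
  have sρ := hE.smooth_density.hasDerivWithinAt_slice ht x
  have hζ := (hasDerivAt_zetaF hFa (packing_mem hE hσ hpack ht x).2).comp_hasDerivWithinAt t sρ
  simp only [Function.comp_def] at hζ
  have h := sρ.fun_mul hζ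
  unfold Torus.timeDerivWithin at h ⊢
  beta_reduce
  rw [h.derivWithin (hU t ht)]
  ring

/-- **`∂ₜλ·U = γ ∂ₜρ = ∂ₜ(ρZ(ρσ³))`** along the solution. -/
theorem pair_timeDeriv_entropyVar_consVar_eq (hE : IsHardSphereEulerSolution σ T ρ u θ) (hσ : 0 < σ)
    (hFa : AnalyticOnNhd ℝ F (Ioo (-η₀) η₀)) (hF : EqOn hsExcessFreeEnergy F (Ico 0 η₀))
    (hpack : ∀ t ∈ Ico 0 T, ∀ x, ρ t x * σ ^ 3 < η₀)
    (pair : (ℝ × V3 × ℝ) → (ℝ × V3 × ℝ) → ℝ)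
    (hpair : pair = fun L U => L.1 * U.1 + (∑ j, L.2.1 j * U.2.1 j) + L.2.2 * U.2.2)
    {t : ℝ} (ht : t ∈ Ico 0 T) (x : T3) :
    pair (Torus.timeDerivWithin (Ico 0 T) (fun s y => ((-(3 / 2 * Real.log (θ s y) -
        Real.log (ρ s y) - hsExcessFreeEnergy (ρ s y * σ ^ 3)) + 5 / 2 - ‖u s y‖ ^ 2 / (2 * θ s y) +
        ρ s y * σ ^ 3 * deriv hsExcessFreeEnergy (ρ s y * σ ^ 3) : ℝ),
        (θ s y)⁻¹ • u s y, -(θ s y)⁻¹)) t x)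
      (ρ t x, ρ t x • u t x, totalEnergyDensity (ρ t x) (u t x) (θ t x)) =
      Torus.timeDerivWithin (Ico 0 T)
        (fun s y => ρ s y * (1 + ρ s y * σ ^ 3 * deriv F (ρ s y * σ ^ 3))) t x := by
  rw [timeDerivWithin_entropyVar_eq hE hσ hFa hF hpack ht x, timeDerivWithin_rhoZ_eq hE hσ hFa hpack ht x]
  have hρ0 : ρ t x ≠ 0 := (hE.density_pos t ht x).ne'
  have hθ0 : θ t x ≠ 0 := (hE.temperature_pos t ht x).ne'
  subst hpair
  simp only [totalEnergyDensity, PiLp.add_apply, PiLp.smul_apply, smul_eq_mul,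
    EuclideanSpace.norm_sq_eq, Real.norm_eq_abs, sq_abs, Fin.sum_univ_three]
  field_simp
  ring

/-- The spatial derivative of `ρ Z(ρσ³) uᵢ` along a coordinate line. -/
theorem partialDeriv_rhoZu_eq (hE : IsHardSphereEulerSolution σ T ρ u θ) (hσ : 0 < σ)
    (hFa : AnalyticOnNhd ℝ F (Ioo (-η₀) η₀)) (hpack : ∀ t ∈ Ico 0 T, ∀ x, ρ t x * σ ^ 3 < η₀)
    {t : ℝ} (ht : t ∈ Ico 0 T) (x : T3) (i : Fin 3) :
    Torus.partialDeriv i (fun y => ρ t y * (1 + ρ t y * σ ^ 3 * deriv F (ρ t y * σ ^ 3)) * u t y i) x =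
      (1 + 2 * (ρ t x * σ ^ 3) * deriv F (ρ t x * σ ^ 3) +
          (ρ t x * σ ^ 3) ^ 2 * deriv (deriv F) (ρ t x * σ ^ 3)) *
        Torus.partialDeriv i (ρ t) x * u t x i +
      ρ t x * (1 + ρ t x * σ ^ 3 * deriv F (ρ t x * σ ^ 3)) * Torus.partialDeriv i (fun y => u t y i) x := by
  have hρ1 : Torus.IsContDiff 1 (ρ t) := (hE.smooth_density.isSmooth_slice ht).isContDiff (by simp)
  have hu1 : Torus.IsContDiff 1 (u t) := (hE.smooth_velocity.isSmooth_slice ht).isContDiff (by simp)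
  have hui : Torus.IsContDiff 1 (fun y => u t y i) := HsEulerCalc.isContDiff_apply_coord hu1 i
  have cρ := HsEulerCalc.hasDerivAt_coordLine hρ1 x i
  have cu := HsEulerCalc.hasDerivAt_coordLine hui x i
  have hmem : ρ t (x + Torus.proj ((0 : ℝ) • EuclideanSpace.single i (1 : ℝ))) * σ ^ 3 ∈ Ioo (-η₀) η₀ := by
    simp only [zero_smul, Torus.proj_zero, add_zero]
    exact (packing_mem hE hσ hpack ht x).2
  have cζ := (hasDerivAt_zetaF hFa hmem).comp 0 cρ
  have h := (cρ.fun_mul cζ).fun_mul cu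
  simp only [Function.comp_apply, zero_smul, Torus.proj_zero, add_zero] at h
  refine HsEulerCalc.partialDeriv_eq_of_hasDerivAt (h.congr_deriv ?_)
  ring

/-- **`Σᵢ ∂ᵢλ·fᵢ(U) = Σᵢ ∂ᵢ(ρZ(ρσ³)uᵢ)`** along the solution (pointwise, term by term in `i`). -/
theorem pair_partialDeriv_entropyVar_flux_eq (hE : IsHardSphereEulerSolution σ T ρ u θ) (hσ : 0 < σ)
    (hFa : AnalyticOnNhd ℝ F (Ioo (-η₀) η₀)) (hF : EqOn hsExcessFreeEnergy F (Ico 0 η₀))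
    (hpack : ∀ t ∈ Ico 0 T, ∀ x, ρ t x * σ ^ 3 < η₀)
    (θo : (ℝ × V3 × ℝ) → ℝ)
    (hθo : θo = fun U => 2 / 3 * (U.2.2 / U.1 - ‖U.2.1‖ ^ 2 / (2 * U.1 ^ 2)))
    (flux : Fin 3 → (ℝ × V3 × ℝ) → (ℝ × V3 × ℝ))
    (hflux : flux = fun i U => (U.2.1 i, (U.2.1 i / U.1) • U.2.1 +
      hsPressure σ U.1 (θo U) • EuclideanSpace.single i (1 : ℝ),
      (U.2.2 + hsPressure σ U.1 (θo U)) * U.2.1 i / U.1))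
    (pair : (ℝ × V3 × ℝ) → (ℝ × V3 × ℝ) → ℝ)
    (hpair : pair = fun L U => L.1 * U.1 + (∑ j, L.2.1 j * U.2.1 j) + L.2.2 * U.2.2)
    {t : ℝ} (ht : t ∈ Ico 0 T) (x : T3) (i : Fin 3) :
    pair (Torus.partialDeriv i (fun y => ((-(3 / 2 * Real.log (θ t y) - Real.log (ρ t y) -
        hsExcessFreeEnergy (ρ t y * σ ^ 3)) + 5 / 2 - ‖u t y‖ ^ 2 / (2 * θ t y) +
        ρ t y * σ ^ 3 * deriv hsExcessFreeEnergy (ρ t y * σ ^ 3) : ℝ),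
        (θ t y)⁻¹ • u t y, -(θ t y)⁻¹)) x)
      (flux i (ρ t x, ρ t x • u t x, totalEnergyDensity (ρ t x) (u t x) (θ t x))) =
      Torus.partialDeriv i
        (fun y => ρ t y * (1 + ρ t y * σ ^ 3 * deriv F (ρ t y * σ ^ 3)) * u t y i) x := by
  rw [partialDeriv_entropyVar_eq hE hσ hFa hF hpack ht x i, partialDeriv_rhoZu_eq hE hσ hFa hpack ht x i]
  have hρ0 : ρ t x ≠ 0 := (hE.density_pos t ht x).ne'
  have hθ0 : θ t x ≠ 0 := (hE.temperature_pos t ht x).ne'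
  obtain ⟨-, -, e3⟩ := eos_eqs hF (θ t x) (packing_mem hE hσ hpack ht x).1
  have hu1 : Torus.IsContDiff 1 (u t) := (hE.smooth_velocity.isSmooth_slice ht).isContDiff (by simp)
  rw [Torus.partialDeriv_apply_coord hu1 i x i]
  subst hflux hpair
  simp only [thetaOf_consVar θo hθo hρ0, e3]
  fin_cases i <;>
  · simp only [PiLp.add_apply, PiLp.smul_apply, PiLp.single_apply, smul_eq_mul,
      totalEnergyDensity, EuclideanSpace.norm_sq_eq, Real.norm_eq_abs, sq_abs, Fin.sum_univ_three,
      Fin.isValue, Fin.zero_eta, Fin.mk_one, Fin.reduceFinMk, Fin.reduceEq, if_true, if_false,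
      mul_one, mul_zero, add_zero]
    field_simp
    ring

end Solution

end Summit.AtomisticToContinuum.HydrodynamicLimit.Theorems.EntropicWeakStrong

end
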